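import Mathlib
import Literature.Analysis.FluidPDE.VectorCalculus
import Literature.Analysis.FluidPDE.AxisymmetricEuler
import Literature.Analysis.FluidPDE.AxisymmetricVorticityTransport
import Literature.Analysis.FluidPDE.SwirlTransportProofs
import Summits.NavierStokesRegularity.NavierStokesRegularity.Theorems.ThreadingFluxHorizonTowerDefs
import HarnessLib

/-!
# Crux `PoloidalLiouville` (stmt-NavierStokesRegularity-1222, W1), crux idea «silent-shells» (ns-idea-15 g8):
# tools for (O2) `TwoAxesTrivial` — infinitesimal rotations as cross products

Elementary `ℝ³` facts used by `Theorems/ThreadingFluxSilentShellsTwoAxes.lean`: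

* `rotGen = e_z × ·`, `R_θ (u × v) = R_θ u × R_θ v`, skewness of `rotGen`;
* `TwoAxes.exists_cross_of_skew` — every skew-adjoint linear map of `ℝ³` is `x ↦ w × x` (axial vector);
* `TwoAxes.fderiv_conj_generator` — transport of an infinitesimal-symmetry identity `DV(x)[G x] = G(V x)` under conjugation
  `V ↦ A⁻¹ ∘ V ∘ A` by a linear isometry;
* `TwoAxes.forall_of_span` — `e_z`, `w`, `R_{π/2} w` span `ℝ³` when `w` is not axial;
* `TwoAxes.divergence_smul_id` — `div (f · x) = Df(x)[x] + 3 f(x)`;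
* `isAxisymmetric_of_locallyAxisymmetric` — local axisymmetry of a real-analytic field propagates (identity theorem; ported
  from the sketch's kernel lemma).

Helper lemmas only; no Prop of the sketch is restated; NS regularity is NOT proved by any of this.
-/

-- the summit and its single problem share the name (D-0017 nested layout)
set_option linter.dupNamespace false

noncomputable section

namespace Summit.NavierStokesRegularity.NavierStokesRegularity.Theorems.PoloidalLiouville.SilentShells

open Set Function Filter Topology Metric
open scoped Topology RealInnerProductSpace
open Literature.Analysis.FluidPDE
open Summit.NavierStokesRegularity.NavierStokesRegularity.Theorems.PoloidalLiouville.HorizonTower (E3)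

namespace TwoAxes

/-- The rotation generator is the cross product with the axis: `J x = e_z × x`. -/
theorem rotGen_eq_cross (x : E3) : rotGen x = cross eZ x := by
  ext i; fin_cases i <;> simp [rotGen, cross, crossProduct, eZ]

/-- Rotations about the axis preserve the cross product. -/
theorem rotZ_cross (θ : ℝ) (u v : E3) : rotZ θ (cross u v) = cross (rotZ θ u) (rotZ θ v) := by
  ext i; fin_cases i
  · simp [rotZ, cross, crossProduct]; ring
  · simp [rotZ, cross, crossProduct]; ring
  · simp [rotZ, cross, crossProduct]
    linear_combination (u 1 * v 0 - u 0 * v 1) * Real.sin_sq_add_cos_sq θ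

/-- The generator is skew: `⟪J u, v⟫ = −⟪u, J v⟫`. -/
theorem inner_rotGen_skew (u v : E3) : ⟪rotGen u, v⟫ = -⟪u, rotGen v⟫ := by
  simp only [EuclideanSpace.inner_eq_star_dotProduct, rotGen]
  simp [dotProduct, Fin.sum_univ_three]

/-- **Skew maps of `ℝ³` are cross products**: if `⟪G x, y⟫ = −⟪x, G y⟫` for all `x, y`, then `G = w × ·` for the axial vector
`w = (⟪G e₁, e₂⟫, ⟪G e₂, e₀⟫, ⟪G e₀, e₁⟫)`. -/
theorem exists_cross_of_skew (G : E3 →L[ℝ] E3) (hG : ∀ x y : E3, ⟪G x, y⟫ = -⟪x, G y⟫) :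
    ∃ w : E3, ∀ x, G x = cross w x := by
  set e : Fin 3 → E3 := fun i => EuclideanSpace.single i (1 : ℝ) with he
  refine ⟨WithLp.toLp 2 ![⟪G (e 1), e 2⟫, ⟪G (e 2), e 0⟫, ⟪G (e 0), e 1⟫], fun x => ?_⟩
  have hx : x = x 0 • e 0 + x 1 • e 1 + x 2 • e 2 := by
    ext i; fin_cases i <;> simp [he]
  have hGi : ∀ (y : E3) (i : Fin 3), G y i = ⟪G y, e i⟫ := by
    intro y i; simp [he, EuclideanSpace.inner_single_right]
  have hdiag : ∀ i, ⟪G (e i), e i⟫ = 0 := by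
    intro i; have h := hG (e i) (e i); rw [← real_inner_comm (e i) (G (e i))] at h; linarith
  have hskew : ∀ i j, ⟪G (e i), e j⟫ = -⟪G (e j), e i⟫ := by
    intro i j; rw [hG, real_inner_comm]
  have hGx : G x = x 0 • G (e 0) + x 1 • G (e 1) + x 2 • G (e 2) := by
    conv_lhs => rw [hx]
    simp only [map_add, map_smul]
  ext i
  rw [hGi, hGx]
  simp only [inner_add_left, real_inner_smul_left]
  fin_cases i
  · simp [cross, crossProduct, hdiag, hskew 1 0]; ring
  · simp [cross, crossProduct, hdiag, hskew 2 1]; ring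
  · simp [cross, crossProduct, hdiag, hskew 2 0]; ring

/-- Chain rule for the conjugate `y ↦ A⁻¹ (V (A y))` of a vector field by a linear isometry. -/
theorem hasFDerivAt_conj (A : E3 ≃ₗᵢ[ℝ] E3) {V : E3 → E3} {y : E3} (hV : DifferentiableAt ℝ V (A y)) :
    HasFDerivAt (fun y => A.symm (V (A y)))
      ((A.symm.toContinuousLinearEquiv : E3 →L[ℝ] E3).comp ((fderiv ℝ V (A y)).comp
        (A.toContinuousLinearEquiv : E3 →L[ℝ] E3))) y := by
  have hA : HasFDerivAt (fun y : E3 => A y) (A.toContinuousLinearEquiv : E3 →L[ℝ] E3) y :=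
    A.toContinuousLinearEquiv.hasFDerivAt
  have hAs : HasFDerivAt (fun z : E3 => A.symm z) (A.symm.toContinuousLinearEquiv : E3 →L[ℝ] E3) (V (A y)) :=
    A.symm.toContinuousLinearEquiv.hasFDerivAt
  exact hAs.comp y (hV.hasFDerivAt.comp y hA)

/-- **Transport of an infinitesimal symmetry under conjugation.**  If the conjugate `W = A⁻¹ ∘ V ∘ A` of a differentiable
field `V` by a linear isometry `A` satisfies `DW(y)[G y] = G (W y)` for all `y`, then `V` satisfies the same identity for the
conjugated generator `A ∘ G ∘ A⁻¹`: `DV(x)[A (G (A⁻¹ x))] = A (G (A⁻¹ (V x)))`. -/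
theorem fderiv_conj_generator (A : E3 ≃ₗᵢ[ℝ] E3) {V : E3 → E3} (hV : Differentiable ℝ V) {G : E3 → E3}
    (h : ∀ y, fderiv ℝ (fun y => A.symm (V (A y))) y (G y) = G (A.symm (V (A y)))) (x : E3) :
    fderiv ℝ V x (A (G (A.symm x))) = A (G (A.symm (V x))) := by
  have hy := h (A.symm x)
  rw [(hasFDerivAt_conj A (hV _)).fderiv] at hy
  simp only [ContinuousLinearMap.comp_apply, LinearIsometryEquiv.apply_symm_apply] at hy
  have hy' := congrArg A hy
  simpa using hy'

/-- **Spanning**: if a property of vectors is stable under two-term linear combinations and holds for `e_z`, for `w` and for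
`R_{π/2} w`, where `w` is not on the axis (`w₀² + w₁² ≠ 0`), then it holds for every vector. -/
theorem forall_of_span {P : E3 → Prop} (hlin : ∀ (a b : ℝ) (u v : E3), P u → P v → P (a • u + b • v))
    (hz : P eZ) {w : E3} (hw : P w) (hw' : P (rotZ (Real.pi / 2) w)) (hne : w 0 ^ 2 + w 1 ^ 2 ≠ 0) :
    ∀ n : E3, P n := by
  set s : ℝ := w 0 ^ 2 + w 1 ^ 2 with hs
  have hh : P ((1 : ℝ) • w + (-(w 2)) • eZ) := hlin _ _ _ _ hw hz
  have hh' : P ((1 : ℝ) • rotZ (Real.pi / 2) w + (-(w 2)) • eZ) := hlin _ _ _ _ hw' hz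
  have he0 : P (EuclideanSpace.single 0 (1 : ℝ)) := by
    have h := hlin (w 0 / s) (-(w 1) / s) _ _ hh hh'
    convert h using 1
    ext i; fin_cases i <;> simp [eZ, rotZ, Real.cos_pi_div_two, Real.sin_pi_div_two] <;> field_simp <;> ring
  have he1 : P (EuclideanSpace.single 1 (1 : ℝ)) := by
    have h := hlin (w 1 / s) (w 0 / s) _ _ hh hh'
    convert h using 1
    ext i; fin_cases i <;> simp [eZ, rotZ, Real.cos_pi_div_two, Real.sin_pi_div_two] <;> field_simp <;> ring
  intro n
  have h01 := hlin (n 0) (n 1) _ _ he0 he1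
  have h := hlin 1 (n 2) _ _ h01 hz
  convert h using 1
  ext i; fin_cases i <;> simp [eZ]

/-- **Divergence of a radial-type field** `y ↦ f(y) y`: `div (f · id)(x) = Df(x)[x] + 3 f(x)`. -/
theorem divergence_smul_id {f : E3 → ℝ} {x : E3} (hf : DifferentiableAt ℝ f x) :
    VectorCalculus.divergence (fun y : E3 => f y • y) x = fderiv ℝ f x x + 3 * f x := by
  have hD : fderiv ℝ (fun y : E3 => f y • y) x
      = f x • ContinuousLinearMap.id ℝ E3 + (fderiv ℝ f x).smulRight x :=
    (hf.hasFDerivAt.smul (hasFDerivAt_id x)).fderiv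
  set b : OrthonormalBasis (Fin 3) ℝ E3 := EuclideanSpace.basisFun (Fin 3) ℝ with hb
  rw [divergence_eq_sum_inner_fderiv b, hD]
  have hbi : ∀ i, b i = EuclideanSpace.single i (1 : ℝ) := fun i => by simp [hb]
  have hxsum : x = ∑ i, x i • b i := by
    ext j; simp [hbi, Fin.sum_univ_three]
    fin_cases j <;> simp
  have hfx : fderiv ℝ f x x = ∑ i, x i * fderiv ℝ f x (b i) := by
    calc fderiv ℝ f x x = fderiv ℝ f x (∑ i, x i • b i) := by rw [← hxsum]
      _ = ∑ i, x i * fderiv ℝ f x (b i) := by rw [map_sum]; simp only [map_smul, smul_eq_mul]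
  rw [hfx]
  simp [Fin.sum_univ_three, hbi, EuclideanSpace.inner_single_left, inner_add_right]
  ring

end TwoAxes

/-- **Local axisymmetry propagates for real-analytic fields** (identity theorem): an analytic `V` axisymmetric on a nonempty
open set is axisymmetric on `ℝ³` (ported from the sketch's kernel lemma `isAxisymmetric_of_locallyAxisymmetric`). -/
theorem isAxisymmetric_of_locallyAxisymmetric {V : E3 → E3} (hV : AnalyticOnNhd ℝ V univ)
    {S : Set E3} (hS : IsOpen S) (hne : S.Nonempty)
    (hloc : ∀ θ : ℝ, ∀ x ∈ S, V (rotZ θ x) = rotZ θ (V x)) : IsAxisymmetric V := by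
  intro θ
  obtain ⟨z₀, hz₀⟩ := hne
  have hf : AnalyticOnNhd ℝ (fun x => V (rotZ θ x)) univ := by
    have e : (fun x => V (rotZ θ x)) = V ∘ (rotZL θ) := by
      ext x; simp
    rw [e]
    exact hV.comp ((rotZL θ).analyticOnNhd _) (mapsTo_univ _ _)
  have hg : AnalyticOnNhd ℝ (fun x => rotZ θ (V x)) univ := by
    have e : (fun x => rotZ θ (V x)) = (rotZL θ) ∘ V := by
      ext x; simp
    rw [e]
    exact ((rotZL θ).analyticOnNhd _).comp hV (mapsTo_univ _ _)
  have heq : (fun x => V (rotZ θ x)) =ᶠ[𝓝 z₀] (fun x => rotZ θ (V x)) := by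
    filter_upwards [hS.mem_nhds hz₀] with x hx using hloc θ x hx
  intro x
  exact hf.eqOn_of_preconnected_of_eventuallyEq hg isPreconnected_univ (mem_univ z₀) heq (mem_univ x)

end Summit.NavierStokesRegularity.NavierStokesRegularity.Theorems.PoloidalLiouville.SilentShells

end
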